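import Literature.Geometry.Riemannian.BishopBoundNullSpheres
import Literature.Geometry.Riemannian.NonTrappingConvexSublevelProofs
import Mathlib.Topology.MetricSpace.GromovHausdorff
import HarnessLib

/-!
# Gromov's precompactness theorem under a lower Ricci curvature bound

M. Gromov, *Structures métriques pour les variétés riemanniennes* (1981), 5.3; in the form used
throughout Cheeger–Colding (1996, §5, proof of Thm. 5.12: "from Gromov's compactness theorem,
a space … which is the Gromov–Hausdorff limit of …"; 1997, §1): **the class of closed connected
Riemannian `d`-manifolds with `Ric ≥ -(d-1)` and `diam ≤ D` is precompact (totally bounded) in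
the Gromov–Hausdorff space.** We PROVE it (`totallyBounded_ghSpace_of_ricci_ge_neg`) from
Mathlib's abstract criterion `GromovHausdorff.totallyBounded` (uniform diameter bound and
uniformly bounded covering numbers at every scale) and the tree's covering-number bound from
relative volume comparison, `exists_finset_cover_ball_of_ricci_ge_neg` (Cheeger–Colding 1997,
§1, (1.14)–(1.18): at most `V(2R + ε/2)/V(ε/2)` balls of radius `ε` cover `B_R`,
`V(ρ) = ∫₀^ρ sinh^{d-1}`). Zhu 1997, Thm. 2.3 / Petersen 2016, Cor. 11.1.13.
No definitions, no named facts (D-0026). Groundwork for `CheegerColding1997_sphereStability`.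

## References

* M. Gromov, *Metric structures for Riemannian and non-Riemannian spaces*, Birkhäuser (1999),
  Thm. 5.3. [Gromov1999Metric]
* J. Cheeger, T. H. Colding, J. Differential Geom. 46 (1997) 406–480, §1. [CheegerColding1997]
* S.-H. Zhu, in *Comparison Geometry*, MSRI Publ. 30 (1997), Thm. 2.3. [Zhu1997ComparisonRicci]
-/

noncomputable section

open Bundle Set Function Filter MeasureTheory Manifold GromovHausdorff
open scoped Manifold ContDiff Topology ENNReal NNReal Cardinal

namespace Literature.Geometry.Riemannian

open Lorentzian Lorentzian.PseudoRiemannianMetric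

universe u

/-- **Gromov's precompactness theorem, `Ric ≥ -(d-1)`, `diam ≤ D`** (Gromov 1981/1999, Thm. 5.3;
Zhu 1997, Thm. 2.3; as used in Cheeger–Colding 1996 §5 and 1997 §1): the Gromov–Hausdorff
classes of the closed connected Riemannian `d`-manifolds (`d ≥ 1`; smooth metric with
`Ric ≥ -(d-1) g`) of diameter `≤ D` form a totally bounded subset of the Gromov–Hausdorff
space, hence every sequence of them has a Gromov–Hausdorff convergent subsequence (to a compact
metric space). [cite: Gromov1999Metric, Thm. 5.3] [cite: Zhu1997ComparisonRicci, Thm. 2.3]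
[cite: CheegerColding1997, §1, (1.14)–(1.18)] -/
theorem totallyBounded_ghSpace_of_ricci_ge_neg {d : ℕ} (hd : 0 < d) (D : ℝ) :
    TotallyBounded {p : GHSpace | ∃ (M : Type u) (_ : TopologicalSpace M)
      (_ : ChartedSpace (EuclideanSpace ℝ (Fin d)) M)
      (_ : IsManifold 𝓘(ℝ, EuclideanSpace ℝ (Fin d)) ∞ M) (_ : T2Space M) (_ : ConnectedSpace M)
      (_ : CompactSpace M) (_ : MeasurableSpace M) (_ : BorelSpace M)
      (g : PseudoRiemannianMetric 𝓘(ℝ, EuclideanSpace ℝ (Fin d)) ∞ (EuclideanSpace ℝ (Fin d))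
        (TangentSpace 𝓘(ℝ, EuclideanSpace ℝ (Fin d)) : M → Type _)) (_ : g.HasLeviCivita)
      (_ : CovariantDerivative.ContMDiffCovariantDerivative g.leviCivita 1)
      (_ : CovariantDerivative.ContMDiffCovariantDerivative g.leviCivita ∞)
      (hg : g.IsRiemannian),
      (∀ (x : M) (w : TangentSpace 𝓘(ℝ, (EuclideanSpace ℝ (Fin d))) x),
        -((d : ℝ) - 1) * g.val x w w ≤ g.leviCivita.ricci x w w) ∧
      (∀ x y : M, g.edist hg x y ≤ ENNReal.ofReal D) ∧
      p = @toGHSpace M (g.metricSpace hg) inferInstance inferInstance} := by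
  classical
  -- scales `u n = 1/(n+1)` and covering numbers `K n`
  set V : ℝ → ℝ := fun ρ ↦ ∫ t in (0 : ℝ)..ρ, Real.sinh t ^ (d - 1) with hV
  set u : ℕ → ℝ := fun n ↦ 1 / ((n : ℝ) + 1) with hu
  set K : ℕ → ℕ := fun n ↦ ⌊V (2 * (|D| + 1) + u n / 2) / V (u n / 2)⌋₊ + 1 with hK
  refine GromovHausdorff.totallyBounded (C := |D|) (u := u) (K := K)
    tendsto_one_div_add_atTop_nhds_zero_nat ?_ ?_
  · -- uniform diameter bound
    rintro p ⟨M, _, _, _, _, _, _, _, _, g, _, _, _, hg, -, hdiam, rfl⟩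
    letI := g.metricSpace hg
    obtain ⟨e⟩ := (toGHSpace_eq_toGHSpace_iff_isometryEquiv.1
      (GHSpace.toGHSpace_rep (toGHSpace M)) : Nonempty ((toGHSpace M).Rep ≃ᵢ M))
    have h1 : Metric.diam (univ : Set (toGHSpace M).Rep) = Metric.diam (e '' univ) :=
      (e.isometry.diam_image univ).symm
    rw [h1]
    refine Metric.diam_le_of_forall_dist_le (abs_nonneg D) fun x _ y _ ↦ ?_
    rw [PseudoRiemannianMetric.metricSpace_dist hg]
    exact (ENNReal.toReal_le_of_le_ofReal (abs_nonneg D)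
      ((hdiam x y).trans (ENNReal.ofReal_le_ofReal (le_abs_self D))))
  · -- uniform covering numbers
    rintro p ⟨M, _, _, _, _, _, _, _, _, g, _, _, _, hg, hRic, hdiam, rfl⟩ n
    letI := g.metricSpace hg
    haveI : LocallyCompactSpace M := Manifold.locallyCompact_of_finiteDimensional
      𝓘(ℝ, EuclideanSpace ℝ (Fin d))
    haveI : T3Space M := inferInstance
    haveI : Fact ((1 : ℕ∞ω) ≤ (∞ : ℕ∞ω)) := ⟨by exact_mod_cast le_top⟩
    have hc : IsGeodesicallyComplete g.leviCivita :=
      isGeodesicallyComplete_of_compactSpace g (WithTop.coe_le_coe.2 le_top) hg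
    obtain ⟨e⟩ := (toGHSpace_eq_toGHSpace_iff_isometryEquiv.1
      (GHSpace.toGHSpace_rep (toGHSpace M)) : Nonempty ((toGHSpace M).Rep ≃ᵢ M))
    have hun : 0 < u n := by rw [hu]; positivity
    obtain ⟨x₀⟩ := (inferInstance : Nonempty M)
    obtain ⟨S, hcard, -, -, hcov⟩ := exists_finset_cover_ball_of_ricci_ge_neg g hd hg hc hRic x₀
      hun (by positivity : (0 : ℝ) ≤ |D| + 1)
    refine ⟨((S.image e.symm : Finset (toGHSpace M).Rep) : Set (toGHSpace M).Rep), ?_, ?_⟩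
    · -- cardinality
      have h1 : S.card ≤ K n := by
        have h2 : S.card ≤ ⌊V (2 * (|D| + 1) + u n / 2) / V (u n / 2)⌋₊ := Nat.le_floor hcard
        show S.card ≤ ⌊V (2 * (|D| + 1) + u n / 2) / V (u n / 2)⌋₊ + 1
        omega
      rw [Finset.coe_sort_coe, Cardinal.mk_coe_finset]
      exact_mod_cast Finset.card_image_le.trans h1
    · -- covering
      intro z' _
      have hz : e z' ∈ {z : M | g.edist hg x₀ z < ENNReal.ofReal (|D| + 1)} := by
        show g.edist hg x₀ (e z') < ENNReal.ofReal (|D| + 1)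
        exact (hdiam x₀ (e z')).trans_lt ((ENNReal.ofReal_le_ofReal (le_abs_self D)).trans_lt
          ((ENNReal.ofReal_lt_ofReal_iff_of_nonneg (abs_nonneg D)).2 (by linarith)))
      have h := hcov hz
      simp only [mem_iUnion, mem_setOf_eq] at h
      obtain ⟨y, hy, hzy⟩ := h
      simp only [mem_iUnion, Finset.coe_image, mem_image, Finset.mem_coe, exists_prop]
      refine ⟨e.symm y, ⟨y, hy, rfl⟩, ?_⟩
      rw [Metric.mem_ball, ← e.dist_eq, e.apply_symm_apply, dist_comm,
        PseudoRiemannianMetric.metricSpace_dist hg]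
      exact ENNReal.toReal_lt_of_lt_ofReal hzy

/-- **Gromov's compactness theorem, sequential form** (Gromov 1999, Thm. 5.3; the form invoked in
Cheeger–Colding 1996, §5 and 1997, §1: "by Gromov's compactness theorem we obtain a
Gromov–Hausdorff limit"): every sequence of closed connected Riemannian `d`-manifolds with
`Ric ≥ -(d-1)` and `diam ≤ D` has a subsequence converging in the Gromov–Hausdorff space (to a
compact metric space), since the class is totally bounded
(`totallyBounded_ghSpace_of_ricci_ge_neg`) in the complete Gromov–Hausdorff space.
[cite: Gromov1999Metric, Thm. 5.3] [cite: CheegerColding1997, §1] -/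
theorem exists_tendsto_subseq_ghSpace_of_ricci_ge_neg {d : ℕ} (hd : 0 < d) (D : ℝ)
    (X : ℕ → GHSpace)
    (hX : ∀ i, X i ∈ {p : GHSpace | ∃ (M : Type u) (_ : TopologicalSpace M)
      (_ : ChartedSpace (EuclideanSpace ℝ (Fin d)) M)
      (_ : IsManifold 𝓘(ℝ, EuclideanSpace ℝ (Fin d)) ∞ M) (_ : T2Space M) (_ : ConnectedSpace M)
      (_ : CompactSpace M) (_ : MeasurableSpace M) (_ : BorelSpace M)
      (g : PseudoRiemannianMetric 𝓘(ℝ, EuclideanSpace ℝ (Fin d)) ∞ (EuclideanSpace ℝ (Fin d))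
        (TangentSpace 𝓘(ℝ, EuclideanSpace ℝ (Fin d)) : M → Type _)) (_ : g.HasLeviCivita)
      (_ : CovariantDerivative.ContMDiffCovariantDerivative g.leviCivita 1)
      (_ : CovariantDerivative.ContMDiffCovariantDerivative g.leviCivita ∞)
      (hg : g.IsRiemannian),
      (∀ (x : M) (w : TangentSpace 𝓘(ℝ, (EuclideanSpace ℝ (Fin d))) x),
        -((d : ℝ) - 1) * g.val x w w ≤ g.leviCivita.ricci x w w) ∧
      (∀ x y : M, g.edist hg x y ≤ ENNReal.ofReal D) ∧
      p = @toGHSpace M (g.metricSpace hg) inferInstance inferInstance}) :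
    ∃ (Y : GHSpace) (φ : ℕ → ℕ), StrictMono φ ∧ Tendsto (X ∘ φ) atTop (𝓝 Y) := by
  have htb := totallyBounded_ghSpace_of_ricci_ge_neg.{u} hd D
  have hK : IsCompact (closure {p : GHSpace | ∃ (M : Type u) (_ : TopologicalSpace M)
      (_ : ChartedSpace (EuclideanSpace ℝ (Fin d)) M)
      (_ : IsManifold 𝓘(ℝ, EuclideanSpace ℝ (Fin d)) ∞ M) (_ : T2Space M) (_ : ConnectedSpace M)
      (_ : CompactSpace M) (_ : MeasurableSpace M) (_ : BorelSpace M)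
      (g : PseudoRiemannianMetric 𝓘(ℝ, EuclideanSpace ℝ (Fin d)) ∞ (EuclideanSpace ℝ (Fin d))
        (TangentSpace 𝓘(ℝ, EuclideanSpace ℝ (Fin d)) : M → Type _)) (_ : g.HasLeviCivita)
      (_ : CovariantDerivative.ContMDiffCovariantDerivative g.leviCivita 1)
      (_ : CovariantDerivative.ContMDiffCovariantDerivative g.leviCivita ∞)
      (hg : g.IsRiemannian),
      (∀ (x : M) (w : TangentSpace 𝓘(ℝ, (EuclideanSpace ℝ (Fin d))) x),
        -((d : ℝ) - 1) * g.val x w w ≤ g.leviCivita.ricci x w w) ∧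
      (∀ x y : M, g.edist hg x y ≤ ENNReal.ofReal D) ∧
      p = @toGHSpace M (g.metricSpace hg) inferInstance inferInstance}) :=
    htb.closure.isCompact_of_isClosed isClosed_closure
  obtain ⟨Y, -, φ, hφ, hlim⟩ := hK.tendsto_subseq fun i ↦ subset_closure (hX i)
  exact ⟨Y, φ, hφ, hlim⟩

end Literature.Geometry.Riemannian

end
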